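import Literature.NumberTheory.Rogawski1990.ArchCentralLimitCornerRegularityTransport   -- ★ p847246 (this seat, FILE 1): `…_of_perm`, `…_of_neg` — (A6) is frame-bookkeeping-invariant
import Literature.NumberTheory.Rogawski1990.ArchCentralLimitLettersHold                 -- ★ p847160 (this seat): `archCentralLimitCornerRegularity_of_signs` — (A6) at the e-pattern frames (★ p846672 ∘ ★ p846680)
import Literature.NumberTheory.Rogawski1990.ArchCompactPlaceLineDerivatives             -- ★ (A-p18): `contDiff_integral_comp_conj_circleDiagonal_angles_of_posDef` (definite places)
import Literature.NumberTheory.Rogawski1990.ArchCentralLimitChamberSmooth                -- ★ (F0P3a-p02): `contDiff_rhoWeylDelta_angleChart_letterTokens` (the prefactor is smooth in the angles)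
import Literature.NumberTheory.Automorphic.ArchLocalRegularTorusClasses                   -- ★ `re_embedding_ne_zero`
import HarnessLib

/-!
# (A6) HOLDS: HARISH-CHANDRA'S CORNER REGULARITY OF THE INVARIANT INTEGRAL OF `U(σ_w diag α)(ℂ)` AT THE CENTRE — `ArchCentralLimitCornerRegularity L α w` AT EVERY FRAME, NO HYPOTHESIS
# (Harish-Chandra 1975 [H₂] §17 Lemma 17.5; Rogawski 1990 §8.4 p. 126; Warner II Thm. 8.4.3.1 ∕ 8.5.1.1)

Topic `NumberTheory/Rogawski1990`; namespace `Literature.NumberTheory.Rogawski1990`.  THEOREMS ONLY (no `def`, no instance, no notation, no axiom, no named fact, no `sorry`).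
Cell `pub/hodgecm-mathlib`, ENGINE T1 (crux H413 = `stmt-HodgeConjecture-24833`); F0P3a-p09 (g3), 2026-09-01.  DISCHARGES the Literature named fact ★ def
`ArchCentralLimitCornerRegularity` (p843483 — booked as print row «(A6)» when the closer's N1 was paid down; the books later re-denominated it «(A6-lim)» and closed it ★ in-house
at closer ED. 36; the (A6) DEF itself had remained an undischarged Literature fact until this file).

THE PROOF.  Inside the fact's binders the frame is non-degenerate (`α_i ≠ 0`, `σ_wα_i` real ⇒ `re σ_wα_i ≠ 0`, ★ `re_embedding_ne_zero`), so exactly one of eight sign patterns holds: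
* `(+,+,−)` — ★ `archCentralLimitCornerRegularity_of_signs` (p847160: ★ p846672 §1 — Whitney-convex ★ + the closure lemma ★ over Harish-Chandra's chamber jet bounds ★ p846680);
* `(−,−,+)` — the same at `−α`, moved by FILE 1 `…_of_neg` (`U(−H) = U(H)`);
* `(+,−,+)`, `(−,+,−)` — relabel by `swap 1 2` (FILE 1 `…_of_perm`: the prefactor `ρ′Δ` is ALTERNATING, the corner extension is `sign(σ)·H′(θ∘σ)`), then as above;
* `(−,+,+)`, `(+,−,−)` — relabel by `swap 0 2`, then as above;
* `(+,+,+)`, `(−,−,−)` — §1 **`archCentralLimitCornerRegularity_of_definite`**: at a DEFINITE place `G_w` is compact and `θ ↦ Φ_Θ(ζe^{iθ})` is `C^∞` on all of `ℝ³`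
  (★ `contDiff_integral_comp_conj_circleDiagonal_angles_of_posDef`), the prefactor is smooth (★ `contDiff_rhoWeylDelta_angleChart_letterTokens`), so `H := ρ′Δ·Φ_Θ∘chart` on `U := univ` is its own corner extension on every chamber.
§2 **`ArchCentralLimitCornerRegularity_holds : ∀ L [Field L] α w, ArchCentralLimitCornerRegularity L α w`**.
HONEST LABEL: HC_CM is proved only modulo the printed citations until rung 0 closes; this file moves no registry row and no book (#179∕#180 are CLOSED ★ in-house since closer ED. 36 ∕
SdArch ED. 5–6); it makes the (A6) named fact a hypothesis-free Literature theorem (net Literature debt −1).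

## References
* [HarishChandra1975HARRG1] Harish-Chandra, *Harmonic analysis on real reductive groups I*, J. Funct. Anal. 19 (1975), §17 Lemma 17.5.
* [Rogawski1990] J. D. Rogawski, *Automorphic Representations of Unitary Groups in Three Variables*, Ann. of Math. Stud. 123 (1990), §8.4 pp. 126–127.
* [WarnerHASSLG2] G. Warner, *Harmonic Analysis on Semi-Simple Lie Groups II*, Grundlehren 189 (1972), Thm. 8.4.3.1; §8.5.1 Thm. 8.5.1.1.
* [PlatonovRapinchuk1994] V. Platonov, A. Rapinchuk, *Algebraic Groups and Number Theory* (1994), §2.3, §3.2 Thm. 3.1.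
-/

set_option autoImplicit false

noncomputable section

open MeasureTheory Measure Filter Topology NumberField NumberField.InfinitePlace Matrix Equiv
open Literature.NumberTheory.Automorphic Literature.NumberTheory.Automorphic.UnitaryGroup
open scoped MatrixGroups Matrix.Norms.Operator ContDiff ComplexOrder

namespace Literature.NumberTheory.Rogawski1990

section Definite

variable (L : Type) [Field L] (α : Fin 3 → L) (w : {w : InfinitePlace L // IsComplex w})

/-- **(A6) AT A DEFINITE PLACE**: if `σ_w diag α` is positive or negative definite, `G_w` is compact, `θ ↦ Φ_Θ(ζe^{iθ})` is smooth on all of `ℝ³`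
(★ `contDiff_integral_comp_conj_circleDiagonal_angles_of_posDef`) and `H := ρ′Δ·Φ_Θ∘chart_ζ` on `U := univ` is its own `C³` corner extension on every chamber.
[cite: Rogawski1990, §8.4 p. 126] [cite: PlatonovRapinchuk1994, §3.2 Thm. 3.1] -/
theorem archCentralLimitCornerRegularity_of_definite
    (hpos : ((Matrix.diagonal α).map (w.1.embedding : L →+* ℂ)).PosDef ∨ (-((Matrix.diagonal α).map (w.1.embedding : L →+* ℂ))).PosDef) :
    ArchCentralLimitCornerRegularity L α w := by
  intro _ _ hα hreal ν _ _ Θ hΘ hsupp ζ τ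
  haveI : CompactSpace (archLocal L 3 (Matrix.diagonal α) w) := compactSpace_archLocal_of_posDef L 3 α w hpos
  have hΦ := contDiff_integral_comp_conj_circleDiagonal_angles_of_posDef L 3 α w hpos ν Θ hΘ (fun _ : Fin 3 => ζ)
  beta_reduce at hΦ
  exact ⟨Set.univ, _, isOpen_univ, Set.mem_univ _, (((contDiff_rhoWeylDelta_angleChart_letterTokens ζ).mul hΦ).of_le (WithTop.coe_le_coe.mpr le_top)).contDiffOn,
    fun θ _ _ => rfl⟩

end Definite

section Holds

/-- Positivity in `ℂ` (the `ComplexOrder`) from a positive real part and zero imaginary part. [cite: Rogawski1990, §8.4 p. 126] -/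
theorem complex_pos_of_re_pos_of_im_eq_zero (x : ℂ) (h1 : 0 < x.re) (h2 : x.im = 0) : 0 < x :=
  Complex.lt_def.mpr ⟨by simpa using h1, by simpa using h2.symm⟩

/-- **(A6) HOLDS AT EVERY FRAME — `ArchCentralLimitCornerRegularity L α w` with no hypothesis** (Harish-Chandra's corner regularity of `ρ′Δ·Φ_Θ` at the centre of the diagonal torus
of `U(σ_w diag α)(ℂ) ≅ U(2,1)` or `U(3)`): the e-pattern frames by ★ p847160 ∘ ★ p846672 ∘ ★ p846680, the other indefinite patterns by FILE 1's relabelling ∕ sign transports,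
the definite frames by §1. [cite: HarishChandra1975HARRG1, §17 Lemma 17.5] [cite: Rogawski1990, §8.4 pp. 126–127] [cite: WarnerHASSLG2, Thm. 8.4.3.1; §8.5.1 Thm. 8.5.1.1] -/
theorem ArchCentralLimitCornerRegularity_holds :
    ∀ (L : Type) [Field L] (α : Fin 3 → L) (w : {w : InfinitePlace L // IsComplex w}), ArchCentralLimitCornerRegularity L α w := by
  intro L _ α w _ _ hα hreal ν _ _ Θ hΘ hsupp ζ τ
  have hne : ∀ i, (w.1.embedding (α i)).re ≠ 0 := re_embedding_ne_zero L 3 α w hα hreal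
  -- the values of the two relabellings
  obtain ⟨a0, a1, a2⟩ : Equiv.swap (1 : Fin 3) 2 0 = 0 ∧ Equiv.swap (1 : Fin 3) 2 1 = 2 ∧ Equiv.swap (1 : Fin 3) 2 2 = 1 := by decide
  obtain ⟨b0, b1, b2⟩ : Equiv.swap (0 : Fin 3) 2 0 = 2 ∧ Equiv.swap (0 : Fin 3) 2 1 = 1 ∧ Equiv.swap (0 : Fin 3) 2 2 = 0 := by decide
  -- the real parts along `α ↦ −α`
  have hren : ∀ i, (w.1.embedding ((fun j => -α j) i)).re = -(w.1.embedding (α i)).re := fun i => by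
    show (w.1.embedding (-α i)).re = _
    rw [map_neg, Complex.neg_re]
  rcases (hne 0).lt_or_gt with h0 | h0 <;> rcases (hne 1).lt_or_gt with h1 | h1 <;> rcases (hne 2).lt_or_gt with h2 | h2
  · -- (−,−,−): negative definite
    refine archCentralLimitCornerRegularity_of_definite L α w (Or.inr ?_) hα hreal ν Θ hΘ hsupp ζ τ
    rw [Matrix.diagonal_map (map_zero _), Matrix.diagonal_neg, Matrix.posDef_diagonal_iff]
    intro i
    refine complex_pos_of_re_pos_of_im_eq_zero _ ?_ ?_
    · rw [Complex.neg_re, neg_pos]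
      exact match i with | 0 => h0 | 1 => h1 | 2 => h2
    · rw [Complex.neg_im, hreal i, neg_zero]
  · -- (−,−,+): `−α` has the e-pattern
    exact archCentralLimitCornerRegularity_of_neg L α w hreal hne
      (archCentralLimitCornerRegularity_of_signs L (fun j => -α j) w (by rw [hren]; linarith) (by rw [hren]; linarith) (by rw [hren]; linarith)) hα hreal ν Θ hΘ hsupp ζ τ
  · -- (−,+,−): relabel by `swap 1 2` to (−,−,+), then `−α`
    refine archCentralLimitCornerRegularity_of_perm L α w (Equiv.swap 1 2) ?_ hα hreal ν Θ hΘ hsupp ζ τ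
    refine archCentralLimitCornerRegularity_of_neg L (α ∘ ⇑(Equiv.swap 1 2)) w (fun i => hreal _) (fun i => hne _)
      (archCentralLimitCornerRegularity_of_signs L (fun j => -(α ∘ ⇑(Equiv.swap 1 2)) j) w ?_ ?_ ?_)
    · show 0 < (w.1.embedding (-(α (Equiv.swap (1 : Fin 3) 2 0)))).re
      rw [a0, map_neg, Complex.neg_re]; linarith
    · show 0 < (w.1.embedding (-(α (Equiv.swap (1 : Fin 3) 2 1)))).re
      rw [a1, map_neg, Complex.neg_re]; linarith
    · show (w.1.embedding (-(α (Equiv.swap (1 : Fin 3) 2 2)))).re < 0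
      rw [a2, map_neg, Complex.neg_re]; linarith
  · -- (−,+,+): relabel by `swap 0 2` to (+,+,−)
    refine archCentralLimitCornerRegularity_of_perm L α w (Equiv.swap 0 2) ?_ hα hreal ν Θ hΘ hsupp ζ τ
    refine archCentralLimitCornerRegularity_of_signs L (α ∘ ⇑(Equiv.swap 0 2)) w ?_ ?_ ?_
    · show 0 < (w.1.embedding (α (Equiv.swap (0 : Fin 3) 2 0))).re
      rw [b0]; exact h2
    · show 0 < (w.1.embedding (α (Equiv.swap (0 : Fin 3) 2 1))).re
      rw [b1]; exact h1
    · show (w.1.embedding (α (Equiv.swap (0 : Fin 3) 2 2))).re < 0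
      rw [b2]; exact h0
  · -- (+,−,−): relabel by `swap 0 2` to (−,−,+), then `−α`
    refine archCentralLimitCornerRegularity_of_perm L α w (Equiv.swap 0 2) ?_ hα hreal ν Θ hΘ hsupp ζ τ
    refine archCentralLimitCornerRegularity_of_neg L (α ∘ ⇑(Equiv.swap 0 2)) w (fun i => hreal _) (fun i => hne _)
      (archCentralLimitCornerRegularity_of_signs L (fun j => -(α ∘ ⇑(Equiv.swap 0 2)) j) w ?_ ?_ ?_)
    · show 0 < (w.1.embedding (-(α (Equiv.swap (0 : Fin 3) 2 0)))).re
      rw [b0, map_neg, Complex.neg_re]; linarith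
    · show 0 < (w.1.embedding (-(α (Equiv.swap (0 : Fin 3) 2 1)))).re
      rw [b1, map_neg, Complex.neg_re]; linarith
    · show (w.1.embedding (-(α (Equiv.swap (0 : Fin 3) 2 2)))).re < 0
      rw [b2, map_neg, Complex.neg_re]; linarith
  · -- (+,−,+): relabel by `swap 1 2` to (+,+,−)
    refine archCentralLimitCornerRegularity_of_perm L α w (Equiv.swap 1 2) ?_ hα hreal ν Θ hΘ hsupp ζ τ
    refine archCentralLimitCornerRegularity_of_signs L (α ∘ ⇑(Equiv.swap 1 2)) w ?_ ?_ ?_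
    · show 0 < (w.1.embedding (α (Equiv.swap (1 : Fin 3) 2 0))).re
      rw [a0]; exact h0
    · show 0 < (w.1.embedding (α (Equiv.swap (1 : Fin 3) 2 1))).re
      rw [a1]; exact h2
    · show (w.1.embedding (α (Equiv.swap (1 : Fin 3) 2 2))).re < 0
      rw [a2]; exact h1
  · -- (+,+,−): the e-pattern itself
    exact archCentralLimitCornerRegularity_of_signs L α w h0 h1 h2 hα hreal ν Θ hΘ hsupp ζ τ
  · -- (+,+,+): positive definite
    refine archCentralLimitCornerRegularity_of_definite L α w (Or.inl ?_) hα hreal ν Θ hΘ hsupp ζ τ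
    rw [Matrix.diagonal_map (map_zero _), Matrix.posDef_diagonal_iff]
    intro i
    refine complex_pos_of_re_pos_of_im_eq_zero _ ?_ ?_
    · exact match i with | 0 => h0 | 1 => h1 | 2 => h2
    · exact hreal i

end Holds

end Literature.NumberTheory.Rogawski1990

end
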